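import Summits.HodgeConjecture.HodgeConjecture.Theorems.F0P3cStCharTSTorusDefs    -- ★ «TOR-DEFS» (F0∕K2E3 organ vocabulary): `hyperbolicSet` (pin hE); brings `Gqs`, `qsForm`, `cmBorelTriple`, `compactCore`, `OrbitalMeasureFamily.IsCanonical`, `IsLocSmooth`, `IrrClass`
import Summits.HodgeConjecture.HodgeConjecture.Theorems.K2E1bArchPacketSignsDefs  -- ★ E1b U8 leaf: the letter `ArchPacketSignsLetter` (row E3.R1; = S10-E socket `stub_R90_ext_pseudoCoeffDS_u` BY TYPE)
import Literature.NumberTheory.Rogawski1990.Ch12Sec5Inputs                         -- ★ TR carpet, RELATIONS on the §12.5 datum: `WeylDensity`, `EllCartanSubset`, `EllCartanAE`, `NonEllCartanAE`, `L2CharOnTorusAll`, `EllipticOfL2`; brings `Ch12Sec5` (`WeylIntegrationFormula`), `Ch12Sec5Defs` (`EllipticData`)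
import Literature.NumberTheory.Rogawski1990.Ch12Sec6                               -- ★ TR carpet §12.6: `Ch12Sec6.Prop1261a`, `Ch12Sec6.PseudoCoeffExists`, `Ch12Sec6.PseudoCoeffTrace`
import Summits.HodgeConjecture.HodgeConjecture.Theorems.K2E3CharLettersLeThreeDefs -- ★ NR-1′ letters: `characterLocallyIntegrableLeThree` (row E3.P1), `normalizedCharacter_locallyBoundedLeThree` (row E3.P10) — R-S1-7′ (α) «LeThree»
import Literature.NumberTheory.Rogawski1990.ArchLimitFormula                      -- ★ `ArchTorusOrbitalOneSidedLimits`, `ArchLimitFormulaNoncompactWall` (row E3.R2)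
import Literature.NumberTheory.Rogawski1990.ArchCharactersLinIndep                 -- ★ `ArchCharactersLinIndep` (row E3.R5)
import HarnessLib

/-!
# R90-TF · S1 (Rogawski 1990 Ch. 12, local) · THEOREMS — `R90S1ClosureE3Defs`: the DEFINITIONS of the (E3) CLOSURE SOCKET «local harmonic analysis»

Cell hodgecm-mathlib, slab R90-TF (director brief v2), section S1 «Ch10-local» (base R90-C10), crux item h413 = stmt-HodgeConjecture-24833 (route
`route-HodgeConjecture-HCCMUnconditional`).  Pen: R90-C10-typ2 (g2), AUTHOR OF RECORD of the E3 home (RULING R-S1-7 + DEAL S1 WAVE E3, R90-C10-plan (g0)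
2026-09-04T22:11:35Z; R-S1-7′ 22:20:02Z (α) «LeThree» ∕ (β) «pins-then-relation»; HEADS-C.v1 7798dd0d9ab22ca8 «=» AS WRITTEN 22:25:57Z with N1 «= Gqs», N2
«= LeThree», a4 not in ED. 1; audit PRE-READ R90-C10-audit1 (g0) 22:14:29Z (α)∕(β) + 22:25:30Z PASS, MUST-DO 1 (LeThree) ∕ MUST-DO 2 (pins verbatim) ∕ W (witness =
(W-a) equational pins + (W-b) law∕structure pins documented) folded).  LAW L9 «DEFINITIONS DOWN»: this ★ file holds every
DEFINITION the closure socket `stub_R90_ext_E3 : ExtE3` of `Cruxes/H413/Lines/R90_S1_ClosureE3C.lean` needs, so that every payer's ★ `Theorems` file can state the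
socket's conjuncts WITHOUT importing a `Lines` file.  Nothing here is asserted: `structure … : Prop` bundles and one `def … : Prop`; sorry-free; no new carrier.

WHAT (E3) IS.  Closure extension (E3) of `R90_CLOSURE_DAG.md` = «local harmonic analysis» — CLOSURE TARGETS (R90_CLOSURE_DAG rows E3.P1–P15, E3.R1–R6; NR-4
FINAL: BUILD TARGETS above Mathlib, never citations): what [Rogawski1990] Ch. 12 takes from local harmonic analysis at the finite non-split places and at the
real places (CLOSURE-E3.md ED. 1, R90-szE3 (g1); SIZING-E3 §2, R90-szE3 (g0)): Harish-Chandra regularity [H₁], the Weyl integration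
formula and the elliptic inner product (§12.5 p. 182, p. 184), Howe∕Clozel finiteness and `⟨χ_π, χ_π⟩_e = 1` (Prop. 12.6.1 (a)), Kazhdan's pseudo-coefficients [K]
(§12.6 p. 187), `|D|^{1∕2}χ_π` locally bounded ([H₁] Thm 16.3, used p. 193); at ∞: Clozel–Delorme pseudo-coefficients (§13.8 p. 218), Harish-Chandra's limit formula
at a noncompact wall (§8.2 p. 119), linear independence of characters (Prop. 13.8.1 p. 212).

DESIGN (HEADS-C.v1 §0; audit1 PRE-READ (α)∕(β)).  Two kinds of fields, typed differently so that every field is TRUE AS NAMED and junk-free (A1–A6):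
* (α) DATUM-FREE CLOSED Props fielded BY NAME: `ExtE3Fin.regularity := characterLocallyIntegrableLeThree` and `ExtE3Fin.normCharLocBdd :=
  normalizedCharacter_locallyBoundedLeThree` — the ★ NR-1′ NARROWINGS (`K2E3CharLettersLeThreeDefs`) of Harish-Chandra's two letters to rank `2 ≤ N ≤ 3`, Hermitian
  non-degenerate `H ∈ M_N(L)` and NON-SPLIT places `v` only (R-S1-7′ (α) «LeThree»: R90 reads characters only on `U(3)`, `U(2) × U(1)`, `U(1)` at non-split places; =
  the K2E3 organ's L4 tier-0 ED. 4 stubs 1–2 BY TYPE, «one payment, two consumers»; the ∀ `N` Literature Props ★ `Ch1.characterLocallyIntegrable` ∕ ★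
  `normalizedCharacter_locallyBounded` are NR-1′ S-layer generality HC_CM never consumes and are NOT fielded).  NOT covered by the LeThree letters, hence NOT claimed
  here: `N = 1` (abelian) and SPLIT places (`U(N)_v ≅ GL_N`); a consumer reading character regularity there, or on the product `H_v = U(2) × U(1)` as such, opens the
  NAMED ED. 2 junction J-E3-REG-SPLIT ∕ J-E3-REG-H (a separate field at that record carrier, print verbatim) — never a widening back to ∀ `N`.
  `ExtE3Arch.cdPseudoCoeff := ArchPacketSignsLetter` (= S10-E socket `stub_R90_ext_pseudoCoeffDS_u` BY TYPE), `ExtE3Arch.archLimitOneSided ∕ archLimitFormula ∕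
  archCharLinIndep` (the ★ arch Props ∀-closed over their own record binders; their frame guards are internal hypotheses, so they are true AS NAMED).
* (β) RELATIONS ON THE §12.5 DATUM `𝔇 : Ch12Sec5.EllipticData G H` (its ≈45 fields are posited DATA; a bare `∀ 𝔇, relation` is false at junk data, a bare
  `∃ 𝔇, relation` is junk-satisfiable): typed PINS-THEN-RELATION, `∀ ⟪E3-frame⟫ 𝔇, IsRecordDatumG … 𝔇 → ExtE3FinDatum 𝔇`, exactly as the ★ payers of record do
  (★ `K2E3PseudoCoeffTraceOfPins.pseudoCoeffTrace_of_pins`, ★ `K2E3HFieldsLeThree` :189, ★ `F0P3cStCharTSDetField` :35).  CARRIER `G = Gqs L v =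
  (UnitaryGroup.cmDatum L 3 (qsForm L)).Local v` — the local unitary group of record at the quasi-split form, THE binder every K2E3 payer binds («one payment, two
  consumers» literal); `H_v = U(Φ₂)(L⁺_v) × U(Φ₁)(L⁺_v)` spelled as in the organ.  `IsRecordDatumG` = the organ's eighteen G-SIDE PINS VERBATIM (markers hC01 hC03
  hC04 hC05 hE hchar hAll hHaar hcart hHaarG hfinG hker eDG hcovA hncA hcptA hinvT hcoreT of `K2_E3_EllipticInputsSigs_U5Kazhdan.sig_K2E3KazhdanL2Orthonormal`
  :114–152 and of ★ `pseudoCoeffTrace_of_pins`): the measures are the frame's (`μG = νQv`, `μGZ = μZ`), the orbital family is the canonical one (`orb = mQv`,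
  `hm : mQv.IsCanonical … νQv` in the frame), the torus measures carry `IsCanonical`'s own normalisation (`IsInvInvariant`, `compactCore`-mass one) so the Weyl
  formula is consistent with `Φ = orbInt`, the character LAW is a PIN (`hchar`; HC regularity itself is ASSERTED only by (α) `regularity`), the Cartan
  representatives are `M = (cmBorelTriple L 3 v).M` and compact centralizers of regular elements.  FOOTPRINT (data read ⊆ pins, from the carpet bodies):
  `WeylIntegrationFormula` DG cartanAll orb regG μG μT ✓ · `WeylDensity` cartanG regG μG μT ✓ · `EllCartanSubset` cartanAll cartanG ✓ · `EllCartanAE` cartanG ellG μT ✓ ·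
  `NonEllCartanAE` cartanAll cartanG ellG regG μT ✓ · `L2CharOnTorusAll` DG cartanG char μT ✓ · `Ch12Sec6.Prop1261a` char ellG μGZ innerG(DG cartanG μT) ✓ ·
  `Ch12Sec6.PseudoCoeffExists` char ellG orb regG ✓ · `Ch12Sec6.PseudoCoeffTrace` char ellG orb regG innerG μG ✓ · `EllipticOfL2` char ellG μGZ ✓.  CARRIER NOTE
  (N1 «= Gqs»): a consumer at a general Hermitian `H′` (S3-A's frame) transports by ★ `LocalUnitaryGroupCongr` on ITS side (LEAD #32 (G), J-S3-3) — not an S1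
  edition.  SATISFIABILITY (A2; R-S1-7′ (β), audit W): (W-a) the EQUATIONAL pins (`μG_eq μGZ_eq orb_eq regG_iff ellG_iff cartanAll_iff dG_eq` + the free data
  `cartanG`, `μT`, `char`) are witnessed sorry-free in THIS file by ★ `isRecordDatumG_eqPins_exists` (a structure literal, `rfl` ∕ `Iff.rfl`, à la ★
  `F0P3cStCharTSDatumWitness.exists_datum_with_fields`): a §12.5 datum with these equations EXISTS, so the package is not contradictory by shape and no unpinned
  `∃ 𝔇` occurs anywhere; (W-b) the LAW ∕ STRUCTURE pins (`char_law`; `haarM cartanG_spec haarG finG kerG cartanAll_cover cartanAll_nonconj cartanAll_cpt μT_inv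
  μT_core`) are the organ's hypotheses hchar ∕ hHaar hcart hHaarG hfinG hker hcovA hncA hcptA hinvT hcoreT VERBATIM, consistent in print ([H₁] = §1.6 p. 5 for the
  character law; §12.5 p. 182 «set of representatives for the conjugacy classes of Cartan subgroups», p. 184; §3.6 pp. 28–31) — their discharge (Harish-Chandra's
  theorem = field `regularity` + measurable-version surgery; `U(3)(F_v)` Cartan structure theory, partly ★ `K2E3HFieldsLeThree` §5) is the K2E3 estate's standing
  business and every ★ K2E3 payer already carries them as hypotheses (★ `K2E3PseudoCoeffTraceOfPins`, ★ `K2E3EllipticOfL2`, ★ `K2E3KazhdanL2Orthonormal`).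
* NOT fielded in ED. 1 (each a NAMED ED. 2 junction of HEADS-C.v1 §3, because its footprint leaves the G-side pins or its carrier has no record instantiation
  today): label relations `EllipticClassification`∕`EllipticOfNotPrincipalSeries`∕`Prop1261b`∕`Prop1261c`∕`LdsPseudoCoeffTraceH` and `PacketCharHNorm` (J-E3-LABELS;
  rows E3.P6 part, E3.P11), `StableWeylIntegrationFormula`∕`TildeSpec` (J-E3-STABLE), Shalika germs `Ch8Sec1.Prop811∕812a∕812b` over `GermData` (J-E3-GERMS; row E3.P4),
  the ε-twisted relations `Ch12Sec6.EpsEllipticIff … Prop1262b` over `TwistedEllipticData` (J-E3-TW; row E3.P7; the twisted DEFINITIONS f2∕f9∕f10 are typ1's ★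
  `R90S1ClosureE3TwistedDefs`), Arthur's archimedean germ relations `Ch9Sec1.Lemma911`, `Ch9Sec2.*` over `U3SingularityData` (J-E3-R4; row E3.R4); `UpSpec`∕`DownSpec`∕
  Props. 12.5.2–12.5.4 are ★ in house (row E3.P15, not fields); Casselman (E3.P8) ★ in house; f12 (E3.P12) OFF; (E6) `hcFiniteLevel` (E3.P13) is S10-A's by
  reference only; row «E3-c: Harish-Chandra admissibility ∕ rigidity at ∞» is HOSTED by the S9 Defs binder `hF1b` by reference only (LEAD #32 (K); no field, no
  import); off-spherical [KyS] not typed; a3 (E3.R3) OFF unless S6 asks; E3.R6 aside.  EDITION PRINCIPLE (dealer 22:25:57Z): later editions are ADDITIVE ONLY —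
  every field name ∕ type below is byte-preserved; new rows arrive as new pinned fields ∕ structures.

LEDGER (CLOSURE-E3.md ED. 1 row ids → fields; «E3 ED. 1: 8 fields live, 5 + 3 by junction»): E3.P1 → `ExtE3Fin.regularity` · E3.P10 → `ExtE3Fin.normCharLocBdd` ·
E3.P3 → `ExtE3FinDatum.weylIntegration` · E3.P5 → `ExtE3FinDatum.howeL2` · E3.P6 → `ExtE3FinDatum.kazhdanPseudoCoeff` · E3.R1 → `ExtE3Arch.cdPseudoCoeff` · E3.R2 →
`ExtE3Arch.archLimitOneSided`, `ExtE3Arch.archLimitFormula` · E3.R5 → `ExtE3Arch.archCharLinIndep`.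

HONEST LABEL.  HC_CM is proved only modulo the 7 printed citations (2 remaining named inputs: hLiu418 = stmt-HodgeConjecture-24832, h413 = stmt-HodgeConjecture-24833)
until rung 0 closes; this file DEFINES a closure predicate and closes NOTHING at rung 0; REL ≠ ★ ≠ BUILT.

## References
* [Rogawski1990] J. D. Rogawski, *Automorphic Representations of Unitary Groups in Three Variables*, Ann. of Math. Stud. 123 (1990): §1.6 pp. 5–6; §8.2 p. 119;
  §12.5 pp. 182–187; §12.6 pp. 187–189 (Prop. 12.6.1); §12.7 p. 193 (proof of L. 12.7.2); §13.8 Prop. 13.8.1 p. 212, p. 218 (held scan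
  book:rogawski1990-automorphic-representations-unitary-groups-three-variables, chunks p0010, p0175–p0182, p0185).
* [HarishChandra1999AdmissibleDistributions] Harish-Chandra, *Admissible Invariant Distributions on Reductive p-adic Groups* (notes by DeBacker–Sally), ULS 16
  (1999), Part III §16 Thm. 16.3.
* [Kazhdan1986CuspidalGeometry] D. Kazhdan, *Cuspidal geometry of p-adic groups*, J. Analyse Math. 47 (1986), Thm. K (pseudo-coefficients), Thm. F.
* [Clozel1989] L. Clozel, *Invariant harmonic analysis on the Schwartz space of a reductive p-adic group* (Howe's conjecture), in: Harmonic analysis on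
  reductive groups (Bowdoin 1989), Progr. Math. 101.
* [ClozelDelorme1984] L. Clozel, P. Delorme, *Le théorème de Paley–Wiener invariant pour les groupes de Lie réductifs*, Invent. Math. 77 (1984).
* [Varadarajan1989] V. S. Varadarajan, *An Introduction to Harmonic Analysis on Semisimple Lie Groups*, CSAM 16 (1989), §6.4 Thms 18, 20, 22.
* [LabesseLanglands1979] J.-P. Labesse, R. P. Langlands, *L-indistinguishability for SL(2)*, Canad. J. Math. 31 (1979), Lemma 6.1.
-/

set_option autoImplicit false
-- the mandated namespace has the single-problem summit's repeated segment (`HodgeConjecture.HodgeConjecture`)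
set_option linter.dupNamespace false

noncomputable section

open MeasureTheory Measure Filter Topology NumberField IsDedekindDomain
open scoped NNReal Matrix MatrixGroups
open Literature.MeasureTheory.Group
open Literature.NumberTheory.Rogawski1990 Literature.NumberTheory.Rogawski1990.Ch12Sec5
open Literature.NumberTheory.Automorphic Literature.NumberTheory.Automorphic.UnitaryGroup
open Summit.HodgeConjecture.HodgeConjecture.Cruxes.H413.F0P3cStCharTSTorusDefs (hyperbolicSet)
open Summit.HodgeConjecture.HodgeConjecture.Cruxes.H413.K2E1bGKCohomologyU21.U8 (ArchPacketSignsLetter)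
open Summit.HodgeConjecture.HodgeConjecture.Cruxes.H413.K2E3CharLettersLeThreeDefs (characterLocallyIntegrableLeThree normalizedCharacter_locallyBoundedLeThree)

namespace Summit.HodgeConjecture.HodgeConjecture.R90.S1

/-! ## §1 (β) The record pin package of a §12.5 datum on `U(Φ₃)(L⁺_v)` — the K2E3 organ's G-side pins, verbatim -/

section Finite

variable (L : Type) [Field L] [NumberField L] [IsCMField L] (v : HeightOneSpectrum (𝓞 ↥(maximalRealSubfield L)))

/-- **THE RECORD PIN PACKAGE `IsRecordDatumG`** of a §12.5 datum `𝔇 : EllipticData (U(Φ₃)(L⁺_v)) H` against the frame of record — Haar measure `νQv` on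
`G = Gqs L v`, Haar measure `μZ` on `G ⧸ Z(G)`, canonical orbital family `mQv`: the eighteen G-SIDE PINS of the K2E3 organ VERBATIM (markers of
`K2_E3_EllipticInputsSigs_U5Kazhdan.sig_K2E3KazhdanL2Orthonormal`, = the hypotheses of ★ `K2E3PseudoCoeffTraceOfPins.pseudoCoeffTrace_of_pins` plus hC03).
`H` is generic here exactly as in ★ `pseudoCoeffTrace_of_pins` (no pin reads `H`); the closure field `ExtE3Fin.datum` instantiates it at the record
`H_v = U(Φ₂)(L⁺_v) × U(Φ₁)(L⁺_v)` only.  A `structure … : Prop`; nothing is asserted.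
* `μG_eq` (hC01), `μGZ_eq` (hC03), `orb_eq` (hC04): the datum's measures ∕ orbital family ARE the frame's [§12.5 p. 182 «`dg`», «`dg′∕dt`»; §1.6 p. 5].
* `regG_iff` (hC05), `ellG_iff` (hE): `G^r` = ★ `IsRegularElt`, `G^e` = regular and off the regular hyperbolic set ★ `hyperbolicSet` [§12.5 p. 182, p. 184].
* `char_law` (hchar): the CHARACTER LAW AS A PIN — `χ_π` measurable, locally integrable, locally constant on `G^r`, representing `f ↦ Tr π(f)` [§1.6 p. 6]
  (Harish-Chandra regularity itself is ASSERTED by (α) `ExtE3Fin.regularity`, not here).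
* `cartanAll_iff` (hAll), `haarM` (hHaar), `cartanG_spec` (hcart), `haarG` (hHaarG), `finG` (hfinG), `kerG` (hker), `cartanAll_cover` (hcovA),
  `cartanAll_nonconj` (hncA), `cartanAll_cpt` (hcptA), `μT_inv` (hinvT), `μT_core` (hcoreT): the Cartan representatives of the Weyl integration formula are the
  diagonal torus `M = (cmBorelTriple L 3 v).M` and compact centralizers of regular elements, pairwise non-conjugate and covering every regular centralizer; their
  measures are Haar, inversion-invariant, `compactCore`-normalised — ★ `OrbitalMeasureFamily.IsCanonical`'s own convention, so `dg = dγ · (dg∕dγ)` [§12.5 p. 182,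
  p. 184 «normalized so that meas(Z\T) = 1»; §4.3 (4.3.1) p. 43].
* `dG_eq` (eDG): `D_G(g) = |Π_{α}(1 − α(g))|^{1∕2} = (|disc charpoly g| · |det g|⁻²)^{1∕4}` in the product norm over the places `w ∣ v` [§4.9 p. 55].
[cite: Rogawski1990, §12.5 p. 182, p. 184; §4.3 (4.3.1) p. 43; §4.9 p. 55; §1.6 pp. 5–6] -/
structure IsRecordDatumG
    [MeasurableSpace (Gqs L v)]
    [∀ γ : Gqs L v, MeasurableSpace (Gqs L v ⧸ Subgroup.centralizer ({γ} : Set (Gqs L v)))]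
    [MeasurableSpace (Gqs L v ⧸ Subgroup.center (Gqs L v))]
    {H : Type} [Group H] [TopologicalSpace H] [IsTopologicalGroup H] [MeasurableSpace H]
    (νQv : Measure (Gqs L v)) (μZ : Measure (Gqs L v ⧸ Subgroup.center (Gqs L v))) (mQv : OrbitalMeasureFamily (Gqs L v))
    (𝔇 : EllipticData (Gqs L v) H) : Prop where
  /-- hC01 `𝔇.μG = νQv` [§12.5 p. 182]. -/
  μG_eq : 𝔇.μG = νQv
  /-- hC03 `𝔇.μGZ = μZ` [§1.6 p. 5]. -/
  μGZ_eq : 𝔇.μGZ = μZ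
  /-- hC04 `𝔇.orb = mQv` [§12.5 p. 182; §4.3 (4.3.1) p. 43]. -/
  orb_eq : 𝔇.orb = mQv
  /-- hC05 `G^r` = the regular elements [§12.5 p. 182]. -/
  regG_iff : ∀ γ : Gqs L v, γ ∈ 𝔇.regG ↔ IsRegularElt (γ.val : GL (Fin 3) (UnitaryGroup.LocalRing L v))
  /-- hE `G^e` = regular and not hyperbolic [§12.5 p. 184]. -/
  ellG_iff : ∀ γ : Gqs L v, γ ∈ 𝔇.ellG ↔ IsRegularElt (γ.val : GL (Fin 3) (UnitaryGroup.LocalRing L v)) ∧ γ ∉ hyperbolicSet L v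
  /-- hchar the character law as a pin [§1.6 p. 6]. -/
  char_law : ∀ π : IrrClass (Gqs L v), Measurable (𝔇.char π) ∧ LocallyIntegrable (𝔇.char π) 𝔇.μG ∧
    (∀ x ∈ 𝔇.regG, ∀ᶠ y in 𝓝 x, 𝔇.char π y = 𝔇.char π x) ∧
    ∀ φ : Gqs L v → ℂ, IsLocSmooth φ → π.smoothTrace 𝔇.μG φ = ∫ x, φ x * 𝔇.char π x ∂𝔇.μG
  /-- hAll the Cartan representatives are `M` and the elliptic ones [§12.5 p. 182]. -/
  cartanAll_iff : ∀ T : Subgroup (Gqs L v), T ∈ 𝔇.cartanAll ↔ T = (cmBorelTriple L 3 v).M ∨ T ∈ 𝔇.cartanG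
  /-- hHaar `dγ` on `M` is a Haar measure [§12.5 p. 182]. -/
  haarM : (𝔇.μT (cmBorelTriple L 3 v).M).IsHaarMeasure
  /-- hcart each elliptic representative is a compact centralizer of a regular element [§12.5 p. 184]. -/
  cartanG_spec : ∀ T ∈ 𝔇.cartanG, IsCompact (T : Set (Gqs L v)) ∧ ∃ γ₀ : Gqs L v,
    IsRegularElt (γ₀.val : GL (Fin 3) (UnitaryGroup.LocalRing L v)) ∧ T = Subgroup.centralizer ({γ₀} : Set (Gqs L v))
  /-- hHaarG [§12.5 p. 184]. -/
  haarG : ∀ T ∈ 𝔇.cartanG, (𝔇.μT T).IsHaarMeasure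
  /-- hfinG [§12.5 p. 184 «meas(Z\T) = 1»]. -/
  finG : ∀ T ∈ 𝔇.cartanG, IsFiniteMeasure (𝔇.μT T)
  /-- hker the non-regular locus of an elliptic torus lies in finitely many closed non-open subgroups (the `dγ`-null-set device) [§12.5 p. 184]. -/
  kerG : ∀ T ∈ 𝔇.cartanG, ∃ s : Finset (Subgroup ↥T), (∀ K ∈ s, IsClosed (K : Set ↥T) ∧ ¬ IsOpen (K : Set ↥T)) ∧
    ∀ t : ↥T, ¬ IsRegularElt ((t : Gqs L v).val : GL (Fin 3) (UnitaryGroup.LocalRing L v)) → ∃ K ∈ s, t ∈ K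
  /-- eDG the closed form of `D_G` [§4.9 p. 55]. -/
  dG_eq : ∀ g : Gqs L v, 𝔇.DG g = ((NNReal.sqrt (NNReal.sqrt ((∏ w : PlacesOver L v,
    Literature.NumberTheory.GaloisRepresentations.IsNonarchimedeanLocalField.normAbs (w.1.adicCompletion L)
      (((g.val : GL (Fin 3) (UnitaryGroup.LocalRing L v)).val.charpoly.discr) w)) * ((∏ w : PlacesOver L v,
    Literature.NumberTheory.GaloisRepresentations.IsNonarchimedeanLocalField.normAbs (w.1.adicCompletion L)
      (((g.val : GL (Fin 3) (UnitaryGroup.LocalRing L v)).val.det) w)) ^ 2)⁻¹)) : NNReal) : ℝ)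
  /-- hcovA every regular centralizer is conjugate into a representative [§12.5 p. 182]. -/
  cartanAll_cover : ∀ γ : Gqs L v, IsRegularElt (γ.val : GL (Fin 3) (UnitaryGroup.LocalRing L v)) →
    ∃ T' ∈ 𝔇.cartanAll, ∃ x : Gqs L v, ∀ g : Gqs L v, g ∈ Subgroup.centralizer ({γ} : Set (Gqs L v)) ↔ x⁻¹ * g * x ∈ T'
  /-- hncA the representatives are pairwise non-conjugate [§12.5 p. 182]. -/
  cartanAll_nonconj : ∀ T' ∈ 𝔇.cartanAll, ∀ T'' ∈ 𝔇.cartanAll, T' ≠ T'' → ∀ y : Gqs L v, ¬ ∀ h : Gqs L v, h ∈ T'' ↔ y⁻¹ * h * y ∈ T'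
  /-- hcptA every representative other than `M` is compact [§12.5 p. 184]. -/
  cartanAll_cpt : ∀ T' ∈ 𝔇.cartanAll, T' ≠ (cmBorelTriple L 3 v).M → IsCompact (T' : Set (Gqs L v))
  /-- hinvT `dγ` is inversion-invariant [§4.3 (4.3.1) p. 43]. -/
  μT_inv : ∀ T' ∈ 𝔇.cartanAll, (𝔇.μT T').IsInvInvariant
  /-- hcoreT `dγ` gives the compact core mass one (★ `IsCanonical`'s normalisation) [§12.5 p. 184; §4.3 (4.3.1) p. 43]. -/
  μT_core : ∀ T' ∈ 𝔇.cartanAll, 𝔇.μT T' (compactCore ↥T') = 1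

/-- **(W-a) SATISFIABILITY WITNESS of the EQUATIONAL pins of ★ `IsRecordDatumG`** (R-S1-7′ (β) «ONE sorry-free witness per pin package», audit W (W-a); à la ★
`F0P3cStCharTSDatumWitness.exists_datum_with_fields`): for the frame's `νQv`, `μZ`, `mQv` and ANY choice of the free data (elliptic representatives `Sell`, torus
measures `μTf`, character table `char`, the label maps `stG detG pi2 piN`) THERE IS a §12.5 datum `𝔇 : EllipticData (U(Φ₃)(L⁺_v)) H` whose fields satisfy — by `rfl` ∕
`Iff.rfl` — the equational pins `μG_eq μGZ_eq orb_eq regG_iff ellG_iff cartanAll_iff dG_eq` and the equations `cartanG = Sell`, `μT = μTf`, `char = char`; the fifteen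
§12.5 bookkeeping fields no E3 relation reads are set to trivial values (placeholders, honestly not print's objects).  So the pin package is not contradictory by
shape; the LAW ∕ STRUCTURE pins (`char_law`, the Cartan ∕ measure pins) are (W-b): the organ's hypotheses verbatim, discharged by the K2E3 estate (module docstring).
[cite: Rogawski1990, §12.5 pp. 182–184] -/
theorem isRecordDatumG_eqPins_exists
    [MeasurableSpace (Gqs L v)]
    [∀ γ : Gqs L v, MeasurableSpace (Gqs L v ⧸ Subgroup.centralizer ({γ} : Set (Gqs L v)))]
    [MeasurableSpace (Gqs L v ⧸ Subgroup.center (Gqs L v))]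
    {H : Type} [Group H] [TopologicalSpace H] [IsTopologicalGroup H] [MeasurableSpace H]
    (νQv : Measure (Gqs L v)) (μZ : Measure (Gqs L v ⧸ Subgroup.center (Gqs L v))) (mQv : OrbitalMeasureFamily (Gqs L v))
    (Sell : Finset (Subgroup (Gqs L v))) (μTf : (T : Subgroup (Gqs L v)) → Measure ↥T) (char : IrrClass (Gqs L v) → Gqs L v → ℂ)
    (stG detG : (↥(Subgroup.center (Gqs L v)) →* ℂˣ) → IrrClass (Gqs L v)) (pi2 piN : (H →* ℂˣ) → IrrClass (Gqs L v)) :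
    ∃ 𝔇 : EllipticData (Gqs L v) H,
      𝔇.μG = νQv ∧ 𝔇.μGZ = μZ ∧ 𝔇.orb = mQv ∧
      (∀ γ : Gqs L v, γ ∈ 𝔇.regG ↔ IsRegularElt (γ.val : GL (Fin 3) (UnitaryGroup.LocalRing L v))) ∧
      (∀ γ : Gqs L v, γ ∈ 𝔇.ellG ↔ IsRegularElt (γ.val : GL (Fin 3) (UnitaryGroup.LocalRing L v)) ∧ γ ∉ hyperbolicSet L v) ∧
      (∀ T : Subgroup (Gqs L v), T ∈ 𝔇.cartanAll ↔ T = (cmBorelTriple L 3 v).M ∨ T ∈ 𝔇.cartanG) ∧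
      (∀ g : Gqs L v, 𝔇.DG g = ((NNReal.sqrt (NNReal.sqrt ((∏ w : PlacesOver L v,
        Literature.NumberTheory.GaloisRepresentations.IsNonarchimedeanLocalField.normAbs (w.1.adicCompletion L)
          (((g.val : GL (Fin 3) (UnitaryGroup.LocalRing L v)).val.charpoly.discr) w)) * ((∏ w : PlacesOver L v,
        Literature.NumberTheory.GaloisRepresentations.IsNonarchimedeanLocalField.normAbs (w.1.adicCompletion L)
          (((g.val : GL (Fin 3) (UnitaryGroup.LocalRing L v)).val.det) w)) ^ 2)⁻¹)) : NNReal) : ℝ)) ∧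
      𝔇.cartanG = Sell ∧ (∀ T : Subgroup (Gqs L v), 𝔇.μT T = μTf T) ∧ 𝔇.char = char := by
  classical
  refine ⟨{
      ι := 1
      regG := (setOf fun γ : Gqs L v => IsRegularElt (γ.val : GL (Fin 3) (UnitaryGroup.LocalRing L v)))
      ellG := (setOf fun γ : Gqs L v => IsRegularElt (γ.val : GL (Fin 3) (UnitaryGroup.LocalRing L v)) ∧ γ ∉ hyperbolicSet L v)
      regH := ∅
      ellH := ∅
      stConjG := fun _ _ => False
      stConjH := fun _ _ => False
      cartanAll := insert (cmBorelTriple L 3 v).M Sell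
      cartanG := Sell
      stCartanAll := ∅
      stCartanG := ∅
      cartanH := ∅
      cartanHG := ∅
      cartanGH := ∅
      weylF := fun _ => 6
      Δ := Unit
      dTF := fun _ => ∅
      twist := fun _ _ g => g
      kappa := fun _ _ => 0
      W := Unit
      cosetReps := fun _ => ∅
      wAct := fun _ h => h
      wActΔ := fun _ _ d => d
      DG := fun g => ((NNReal.sqrt (NNReal.sqrt ((∏ w : PlacesOver L v,
        Literature.NumberTheory.GaloisRepresentations.IsNonarchimedeanLocalField.normAbs (w.1.adicCompletion L)
          (((g.val : GL (Fin 3) (UnitaryGroup.LocalRing L v)).val.charpoly.discr) w)) * ((∏ w : PlacesOver L v,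
        Literature.NumberTheory.GaloisRepresentations.IsNonarchimedeanLocalField.normAbs (w.1.adicCompletion L)
          (((g.val : GL (Fin 3) (UnitaryGroup.LocalRing L v)).val.det) w)) ^ 2)⁻¹)) : NNReal) : ℝ)
      DH := fun _ => 0
      tau := fun _ => 0
      μG := νQv
      μH := 0
      μGZ := μZ
      μT := μTf
      μTH := fun _ => 0
      orb := mQv
      char := char
      charH := fun _ _ => 0
      IsTransfer := fun _ _ => True
      up := fun _ _ => 0
      down := fun _ _ => 0
      sqPacketsH := ∅
      ldsPackets := ∅
      stG := stG
      detG := detG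
      pi2 := pi2
      piN := piN
      irredPS := ∅ }, rfl, rfl, rfl, fun _ => Iff.rfl, fun _ => Iff.rfl, fun T => Finset.mem_insert, fun _ => rfl, rfl, fun _ => rfl, rfl⟩

/-- **THE FIELDED §12.5∕§12.6 RELATIONS `ExtE3FinDatum 𝔇`** — a bundle of carpet relations BY NAME on a §12.5 datum (asserts nothing by itself; the closure field
`ExtE3Fin.datum` asserts it for the record-pinned data):
* `weylIntegration` (row E3.P3): the Weyl integration formula ★ `WeylIntegrationFormula` «`∫_{Z\G} f α dg = Σ_T |Ω(T,G)|⁻¹ ∫_{Z\T} D_G² Φ(γ,f) α(γ) dγ`» (p. 182) with its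
  tacit companions ★ `WeylDensity`, ★ `EllCartanSubset`, ★ `EllCartanAE`, ★ `NonEllCartanAE` (pp. 182, 184: the singular set is `dγ`-null; elliptic tori lie in `G^e`).
* `howeL2` (row E3.P5): PROPOSITION 12.6.1 (a) ★ `Ch12Sec6.Prop1261a` «`⟨χ_π, χ_π⟩_e ≠ 0`; if `π` is square-integrable then `⟨χ_π, χ_π⟩_e = 1`» ([H₄] Thm 17 + Howe's
  conjecture proved by Clozel, p. 188) with ★ `L2CharOnTorusAll` (`D_G χ_π ∈ L²(T, dγ)`, what makes `⟨ , ⟩_e` converge, pp. 184, 187).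
* `kazhdanPseudoCoeff` (row E3.P6): Kazhdan's pseudo-coefficients ★ `Ch12Sec6.PseudoCoeffExists` «a function `f_π` such that `Φ(γ, f_π) = \overline{χ_π(γ)}` on
  `G^e` and `0` on `G^r − G^e`» ([K] Thm K; p. 187 L9–15), ★ `Ch12Sec6.PseudoCoeffTrace` «By the Weyl integration formula, `Tr(π′(f_π)) = ⟨χ_{π′}, χ_π⟩_e`» (p. 187), and
  ★ `EllipticOfL2` «all representations of `G` which are not of the form `i_G(χ)` are elliptic by [K]» read for `E²(G)` (p. 187).
[cite: Rogawski1990, §12.5 p. 182, p. 184; §12.6 Prop. 12.6.1 (a) pp. 187–188, p. 187] [cite: Kazhdan1986CuspidalGeometry, Thm. K]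
[cite: HarishChandra1970, Thm. 17] [cite: Clozel1989, Howe conjecture] -/
structure ExtE3FinDatum
    [MeasurableSpace (Gqs L v)]
    [∀ γ : Gqs L v, MeasurableSpace (Gqs L v ⧸ Subgroup.centralizer ({γ} : Set (Gqs L v)))]
    [MeasurableSpace (Gqs L v ⧸ Subgroup.center (Gqs L v))]
    {H : Type} [Group H] [TopologicalSpace H] [IsTopologicalGroup H] [MeasurableSpace H]
    (𝔇 : EllipticData (Gqs L v) H) : Prop where
  /-- row E3.P3 [cite: Rogawski1990, §12.5 p. 182, p. 184]. -/
  weylIntegration : 𝔇.WeylIntegrationFormula ∧ 𝔇.WeylDensity ∧ 𝔇.EllCartanSubset ∧ 𝔇.EllCartanAE ∧ 𝔇.NonEllCartanAE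
  /-- row E3.P5 [cite: Rogawski1990, §12.6 Prop. 12.6.1 (a) pp. 187–188]. -/
  howeL2 : Ch12Sec6.Prop1261a 𝔇 ∧ 𝔇.L2CharOnTorusAll
  /-- row E3.P6 [cite: Rogawski1990, §12.6 p. 187] [cite: Kazhdan1986CuspidalGeometry, Thm. K]. -/
  kazhdanPseudoCoeff : Ch12Sec6.PseudoCoeffExists 𝔇 ∧ Ch12Sec6.PseudoCoeffTrace 𝔇 ∧ 𝔇.EllipticOfL2

end Finite

/-! ## §2 The closure predicates `ExtE3Fin`, `ExtE3Arch`, `ExtE3` (closed Props) -/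

/-- **(E3, finite places) `ExtE3Fin`** — the closure predicate «local harmonic analysis at the finite non-split places» (CLOSED `Prop`):
* `regularity` (row E3.P1) := ★ `characterLocallyIntegrableLeThree` — Harish-Chandra: for `2 ≤ N ≤ 3`, Hermitian non-degenerate `H` and NON-SPLIT `v`, the character
  of an irreducible admissible representation of `U(H)(L⁺_v)` is a locally integrable function, locally constant on the regular set [§1.6 p. 5 «by [H₁]»] (R-S1-7′ (α):
  = the K2E3 organ's L4 tier-0 ED. 4 stub 1 BY TYPE; the ∀ `N` Literature Prop ★ `Ch1.characterLocallyIntegrable` is NR-1′ S-layer, not consumed by HC_CM);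
* `normCharLocBdd` (row E3.P10) := ★ `normalizedCharacter_locallyBoundedLeThree` — same range; `|D_G|^{1∕2} χ_π` is locally bounded [§12.7 p. 193; HarishChandra1999
  Thm 16.3] (= L4 tier-0 ED. 4 stub 2 BY TYPE; the ∀ `N` ★ `normalizedCharacter_locallyBounded` is NR-1′ S-layer).  `N = 1` and SPLIT places are NOT covered (named
  ED. 2 junctions J-E3-REG-SPLIT ∕ J-E3-REG-H if a consumer reads them; never a widening to ∀ `N`);
* `datum` (rows E3.P3, E3.P5, E3.P6) := at every CM field `L`, every finite place `v` of `L⁺` that does not split in `L` (`hv`), every Haar measure `νQv` on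
  `G = U(Φ₃)(L⁺_v) = Gqs L v`, Haar `μZ` on `G ⧸ Z(G)` and the CANONICAL orbital family `mQv` (`hm`, ★ `OrbitalMeasureFamily.IsCanonical` at the regular classes):
  every §12.5 datum on `G × H_v`, `H_v = U(Φ₂)(L⁺_v) × U(Φ₁)(L⁺_v)`, that carries the record pins ★ `IsRecordDatumG` satisfies the fielded relations ★ `ExtE3FinDatum`.
  The quotient σ-algebras are instance binders (S3-A's frame :80–82; the K2E3 payers' `letI := borel _` instantiate them).  CARRIER (N1 «= Gqs»): the β-tier lives
  on `Gqs L v` × the `HLoc`-spelled `H_v`, the exact binder every ★ K2E3 payer binds; a consumer at a general Hermitian `H′` (S3-A) transports by ★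
  `LocalUnitaryGroupCongr` on ITS side (LEAD #32 (G), J-S3-3) — not an S1 edition.
[cite: Rogawski1990, §1.6 pp. 5–6; §12.5 pp. 182–184; §12.6 pp. 187–188; §12.7 p. 193] [cite: HarishChandra1999AdmissibleDistributions, Part III §16 Thm. 16.3]
[cite: Kazhdan1986CuspidalGeometry, Thm. K] [cite: Clozel1989, Howe conjecture] -/
structure ExtE3Fin : Prop where
  /-- row E3.P1 (LeThree: `2 ≤ N ≤ 3`, non-split `v`) [cite: Rogawski1990, §1.6 p. 5] [cite: HarishChandra1999AdmissibleDistributions, Part III §16 Thm. 16.3]. -/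
  regularity : characterLocallyIntegrableLeThree
  /-- row E3.P10 (LeThree) [cite: HarishChandra1999AdmissibleDistributions, Part III §16 Thm. 16.3] [cite: Rogawski1990, §12.7 p. 193]. -/
  normCharLocBdd : normalizedCharacter_locallyBoundedLeThree
  /-- rows E3.P3 E3.P5 E3.P6, pins-then-relation at the record frame [cite: Rogawski1990, §12.5 p. 182; §12.6 p. 187]. -/
  datum : ∀ (L : Type) [Field L] [NumberField L] [IsCMField L] (v : HeightOneSpectrum (𝓞 ↥(maximalRealSubfield L))),
    (∀ w : PlacesOver L v, IsCMField.complexConj L • w.1 = w.1) →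
    ∀ [MeasurableSpace (Gqs L v)] [BorelSpace (Gqs L v)]
      [∀ γ : Gqs L v, MeasurableSpace (Gqs L v ⧸ Subgroup.centralizer ({γ} : Set (Gqs L v)))]
      [∀ γ : Gqs L v, BorelSpace (Gqs L v ⧸ Subgroup.centralizer ({γ} : Set (Gqs L v)))]
      [MeasurableSpace (Gqs L v ⧸ Subgroup.center (Gqs L v))] [BorelSpace (Gqs L v ⧸ Subgroup.center (Gqs L v))]
      [MeasurableSpace ((UnitaryGroup.cmDatum L 2 (Matrix.of fun i j : Fin 2 => if i.val + j.val + 1 = 2 then (1 : L) else 0)).Local v ×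
        (UnitaryGroup.cmDatum L 1 (Matrix.of fun i j : Fin 1 => if i.val + j.val + 1 = 1 then (1 : L) else 0)).Local v)]
      (νQv : Measure (Gqs L v)) [νQv.IsHaarMeasure] [νQv.IsMulRightInvariant]
      (μZ : Measure (Gqs L v ⧸ Subgroup.center (Gqs L v))) [μZ.IsHaarMeasure]
      (mQv : OrbitalMeasureFamily (Gqs L v)),
      mQv.IsCanonical (fun γ => IsRegularElt (γ.val : GL (Fin 3) (UnitaryGroup.LocalRing L v))) νQv →
      ∀ 𝔇 : EllipticData (Gqs L v)
          ((UnitaryGroup.cmDatum L 2 (Matrix.of fun i j : Fin 2 => if i.val + j.val + 1 = 2 then (1 : L) else 0)).Local v ×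
            (UnitaryGroup.cmDatum L 1 (Matrix.of fun i j : Fin 1 => if i.val + j.val + 1 = 1 then (1 : L) else 0)).Local v),
        IsRecordDatumG L v νQv μZ mQv 𝔇 → ExtE3FinDatum L v 𝔇

/-- **(E3, real places) `ExtE3Arch`** — the closure predicate «archimedean harmonic analysis» (CLOSED `Prop`):
* `cdPseudoCoeff` (row E3.R1) := ★ `ArchPacketSignsLetter` — Clozel–Delorme pseudo-coefficients for the regular discrete-series packets of `U(2,1)` [§13.8 p. 218;
  ClozelDelorme1984] (= S10-E socket `stub_R90_ext_pseudoCoeffDS_u` BY TYPE);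
* `archLimitOneSided`, `archLimitFormula` (row E3.R2) := ★ `ArchTorusOrbitalOneSidedLimits`, ★ `ArchLimitFormulaNoncompactWall` at every field `L`, diagonal form
  `α` and complex place `w` (their frame guards `α_i ≠ 0`, `(σ_w α_i).im = 0`, indefiniteness sit INSIDE the Props) — Harish-Chandra's limit formula at a noncompact
  wall [§8.2 p. 119 via [A₁] L. 7.1; Varadarajan1989 §6.4 Thms 18, 20, 22];
* `archCharLinIndep` (row E3.R5) := ★ `ArchCharactersLinIndep` at every CM frame `(L, ι, H, T, hT)` and Borel measure `νinf` (its guards — `H` definite off `ι`, `νinf`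
  Haar — are internal hypotheses) — PROPOSITION 13.8.1 for `G′_∞ ∕ K_c` [p. 212; LabesseLanglands1979 L. 6.1].
a3 (E3.R3) OFF; a4 (E3.R4, `Ch9Sec1∕Ch9Sec2` over `U3SingularityData`) is the ED. 2 junction J-E3-R4; E3.R6 aside.
[cite: Rogawski1990, §13.8 p. 218, Prop. 13.8.1 p. 212; §8.2 p. 119] [cite: ClozelDelorme1984] [cite: Varadarajan1989, §6.4 Thm 18, Thm 20, Thm 22]
[cite: LabesseLanglands1979, Lemma 6.1 pp. 768–769] -/
structure ExtE3Arch : Prop where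
  /-- row E3.R1 [cite: Rogawski1990, §13.8 p. 218] [cite: ClozelDelorme1984]. -/
  cdPseudoCoeff : ArchPacketSignsLetter
  /-- row E3.R2 (one-sided limits) [cite: Varadarajan1989, §6.4 Thm 18, Thm 20] [cite: Rogawski1990, §8.2 p. 119]. -/
  archLimitOneSided : ∀ (L : Type) [Field L] (α : Fin 3 → L) (w : {w : InfinitePlace L // InfinitePlace.IsComplex w}),
    ArchTorusOrbitalOneSidedLimits L α w
  /-- row E3.R2 (the limit formula at a noncompact wall) [cite: Varadarajan1989, §6.4 Thm 22, Lemma 21] [cite: Rogawski1990, §8.2 p. 119]. -/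
  archLimitFormula : ∀ (L : Type) [Field L] (α : Fin 3 → L) (w : {w : InfinitePlace L // InfinitePlace.IsComplex w}),
    ArchLimitFormulaNoncompactWall L α w
  /-- row E3.R5 [cite: Rogawski1990, Prop. 13.8.1 p. 212] [cite: LabesseLanglands1979, Lemma 6.1 pp. 768–769]. -/
  archCharLinIndep : ∀ (L : Type) [Field L] [NumberField L] [IsCMField L] (ι : L →+* ℂ) (H : Matrix (Fin 3) (Fin 3) L) (T : GL (Fin 3) ℂ)
    (hT : (T : Matrix (Fin 3) (Fin 3) ℂ)ᴴ * H.map ι * (T : Matrix (Fin 3) (Fin 3) ℂ) = Literature.Geometry.ComplexHyperbolic.BallModel.J)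
    (νinf : @Measure (UnitaryGroup.arch (↥(maximalRealSubfield L)) L (IsCMField.complexConj L) 3 H) (borel _)),
    ArchCharactersLinIndep L ι H T hT νinf

/-- **(E3) `ExtE3`** — the closure predicate «local harmonic analysis» of `R90_CLOSURE_DAG.md` (closure extension (E3), CLOSURE TARGET rows E3.P1 P3 P5 P6 P10 R1 R2 R5; CLOSURE-E3.md
ED. 1): finite places ∧ real places.  The TYPE of the closure socket `stub_R90_ext_E3` of `Cruxes/H413/Lines/R90_S1_ClosureE3C.lean` = BUILD TARGET (NR-4 FINAL).
(Rogawski1990, §1.6 pp. 5–6; §12.5–§12.6 pp. 182–189; §13.8 p. 218) — a route-posited closure-INPUT statement typed over Summits-side carriers (the conjunction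
of the two `structure … : Prop` bundles above, whose fields carry the locators), not a relocatable result of the literature (hence untagged). -/
def ExtE3 : Prop := ExtE3Fin ∧ ExtE3Arch

/-- Unfolding of ★ `ExtE3` (elaboration guard; `Iff.rfl`). [cite: Rogawski1990, §12.5 p. 182] -/
theorem extE3_iff : ExtE3 ↔ ExtE3Fin ∧ ExtE3Arch := Iff.rfl

/-! ## §3 Elaboration guards: the conjuncts consumers read, by projection (no content) -/

example (h : ExtE3) : characterLocallyIntegrableLeThree := h.1.regularity
example (h : ExtE3) : normalizedCharacter_locallyBoundedLeThree := h.1.normCharLocBdd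
example (h : ExtE3) : ArchPacketSignsLetter := h.2.cdPseudoCoeff
example (h : ExtE3) (L : Type) [Field L] (α : Fin 3 → L) (w : {w : InfinitePlace L // InfinitePlace.IsComplex w}) :
    ArchLimitFormulaNoncompactWall L α w := h.2.archLimitFormula L α w

end Summit.HodgeConjecture.HodgeConjecture.R90.S1

end
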